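import Literature.Probability.Percolation.OrientedWalkCounts
import Literature.Probability.Percolation.OrientedWalkSuccessors
import HarnessLib

/-!
# The meeting probability of two oriented walks: `ρ_d ≤ g(d)` and `p_c(ℤ^d) ≤ g(d)`

Topic `Literature/Probability/Percolation`.  Sorry-free, no named facts.  This file proves the
explicit upper bound (4.11) of Bock–Damron–Newman–Sidoravicius, *Percolation of finite clusters
and shielded paths*, J. Stat. Phys. 179 (2020), §4 (proof of Corollary 1.5), for the Cox–Durrett
meeting probability `ρ_d = P(S_k = S'_k, S_{k+1} = S'_{k+1} for some k ≥ 0)` of two independent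
uniform oriented walks, in the finite form needed by `criticalProb_zd_le_of_meetPairs_le`
(`CriticalProbOrientedBound.lean`): for every `n`,

  `meetPairs d n / d^{2n} ≤ rhoHead d + rhoMid d + Σ_{j=1}^{n} (jd)!/((j!)^d d^{jd})`,

where `rhoHead d = 1/d + (1 - 1/d)/d³ + 3(1 - 1/d)/d⁴ + (1 - 1/d)(14 - 1/d)/d⁵` collects
`P(τ̂ = 0), …, P(τ̂ = 4)` (BDNS p. 10: `P(τ̂ = 0) = 1/d`, `P(τ̂ = 1) = 0`, `P(τ̂ = 2) = 1/d³ - 1/d⁴`,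
and the bounds for `P(τ̂ = 3)`, `P(τ̂ = 4)`; we use the successor counts `3d` and `d²` of
`OrientedWalkSuccessors.lean` in place of the paper's `3d - 4` and `d² - 3d + 3`, which only
enlarges the bound), `rhoMid d = Σ_{k=5}^{d} k!/d^{k+1}` (`P(l ≤ τ̂ ≤ d) ≤ Σ (1/d) k!/d^k`) and the
last sum is `P(d < τ̂ < ∞) ≤ Σ_j d^{-jd}(jd)!/(j!)^d`.  Consequently (`criticalProb_zd_le_rho`)
`p_c(ℤ^d) ≤ rhoHead d + rhoMid d + T` for any `T` bounding the partial sums of the last series.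

## Method (finite horizon)

* `meetProb d n z` (`= pairsGe d n z 1 / d^{2n}`, `meetProb_eq`) and the first-meeting densities
  `firstMeet d k z` are defined by the first-step recursion of the difference chain with the
  "already met" indicator `z = 0 ∧ a = a'`; `meetProb d n z = Σ_{k<n} firstMeet d k z`
  (`meetProb_eq_sum_firstMeet`), `firstMeet d k z ≤ diffProb d k z / d` (`firstMeet_le`, i.e.
  `P(τ̂ = k) ≤ P(S_k = S'_k)/d`);
* the values `firstMeet d k 0`, `k ≤ 4`, are bounded by unfolding the recursion through the
  classes `0`, `S₂`, far of `OrientedWalkSuccessors.lean`.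

## References

* B. Bock, M. Damron, C. M. Newman, V. Sidoravicius, J. Stat. Phys. 179 (2020) 789–807,
  arXiv:1811.01678, §4, (4.10)–(4.11). [BockEtAl2020]
* J. T. Cox, R. Durrett, Math. Proc. Cambridge Philos. Soc. 93 (1983) 151–162. [CoxDurrett1983]
-/

noncomputable section

namespace Literature.Probability.Percolation

open Finset Literature.Probability.LatticeModels
open scoped Nat

variable {d : ℕ}

/-! ### The recursions -/

/-- `P(an offset-z common step occurs within n steps)`, by first-step recursion: step `0` is an
(offset-`z`) common step iff `z = 0` and the two letters agree; otherwise continue from the new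
offset `z + e_a - e_{a'}`. [cite: CoxDurrett1983, §3] -/
def meetProb (d : ℕ) : ℕ → Site d → ℝ
  | 0, _ => 0
  | n + 1, z => ((d : ℝ) ^ 2)⁻¹ * ∑ a : Fin d, ∑ a' : Fin d,
      if z = 0 ∧ a = a' then 1 else meetProb d n (z + Pi.single a 1 - Pi.single a' 1)

/-- The density of the FIRST (offset-`z`) common step at step `k` (`z = 0`: `P(τ̂ = k)`).
[cite: BockEtAl2020, §4 (proof of Cor 1.5)] -/
def firstMeet (d : ℕ) : ℕ → Site d → ℝ
  | 0, z => if z = 0 then ((d : ℝ))⁻¹ else 0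
  | k + 1, z => ((d : ℝ) ^ 2)⁻¹ * ∑ a : Fin d, ∑ a' : Fin d,
      if z = 0 ∧ a = a' then 0 else firstMeet d k (z + Pi.single a 1 - Pi.single a' 1)

/-- Unfolding at `0` steps. [folklore] -/
@[simp] theorem meetProb_zero (z : Site d) : meetProb d 0 z = 0 := rfl

/-- Unfolding the recursion. [folklore] -/
theorem meetProb_succ (n : ℕ) (z : Site d) :
    meetProb d (n + 1) z = ((d : ℝ) ^ 2)⁻¹ * ∑ a : Fin d, ∑ a' : Fin d,
      if z = 0 ∧ a = a' then 1 else meetProb d n (z + Pi.single a 1 - Pi.single a' 1) := rfl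

/-- Unfolding at `0` steps. [folklore] -/
theorem firstMeet_zero (z : Site d) : firstMeet d 0 z = if z = 0 then ((d : ℝ))⁻¹ else 0 := rfl

/-- Unfolding the recursion. [folklore] -/
theorem firstMeet_succ (k : ℕ) (z : Site d) :
    firstMeet d (k + 1) z = ((d : ℝ) ^ 2)⁻¹ * ∑ a : Fin d, ∑ a' : Fin d,
      if z = 0 ∧ a = a' then 0 else firstMeet d k (z + Pi.single a 1 - Pi.single a' 1) := rfl

/-- Unfolding the recursion away from `0` (no common step is possible at once). [folklore] -/
theorem firstMeet_succ_of_ne_zero (k : ℕ) {z : Site d} (hz : z ≠ 0) :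
    firstMeet d (k + 1) z = ((d : ℝ) ^ 2)⁻¹ * ∑ a : Fin d, ∑ a' : Fin d,
      firstMeet d k (z + Pi.single a 1 - Pi.single a' 1) := by
  rw [firstMeet_succ]
  simp [hz]

/-- Unfolding the recursion at `0`. [folklore] -/
theorem firstMeet_succ_zero (k : ℕ) :
    firstMeet d (k + 1) 0 = ((d : ℝ) ^ 2)⁻¹ * ∑ a : Fin d, ∑ a' : Fin d,
      if a = a' then 0 else firstMeet d k (Pi.single a 1 - Pi.single a' 1) := by
  rw [firstMeet_succ]
  simp

/-- `firstMeet ≥ 0`. [folklore] -/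
theorem firstMeet_nonneg : ∀ (k : ℕ) (z : Site d), 0 ≤ firstMeet d k z
  | 0, z => by rw [firstMeet_zero]; split_ifs <;> positivity
  | k + 1, z => by
    rw [firstMeet_succ]
    refine mul_nonneg (by positivity) (Finset.sum_nonneg fun a _ => Finset.sum_nonneg fun a' _ => ?_)
    split_ifs
    · exact le_rfl
    · exact firstMeet_nonneg k _

/-! ### Link with the pair counts of `CriticalProbOrientedBound.lean` -/

/-- `pairsGe d n z 1 = d^{2n} · meetProb d n z`. [cite: CoxDurrett1983, §3] -/
theorem pairsGe_one_eq (hd : 1 ≤ d) : ∀ (n : ℕ) (z : Site d),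
    pairsGe d n z 1 = (d : ℝ) ^ (2 * n) * meetProb d n z
  | 0, z => by rw [meetProb_zero, mul_zero]; exact pairsGe_length_zero d z 0
  | n + 1, z => by
    have hd0 : (d : ℝ) ≠ 0 := by exact_mod_cast (show d ≠ 0 by omega)
    rw [pairsGe_succ_one, meetProb_succ, ← mul_assoc,
      show (d : ℝ) ^ (2 * (n + 1)) * ((d : ℝ) ^ 2)⁻¹ = (d : ℝ) ^ (2 * n) by field_simp; ring,
      Finset.mul_sum]
    refine Finset.sum_congr rfl fun a _ => ?_
    rw [Finset.mul_sum]
    refine Finset.sum_congr rfl fun a' _ => ?_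
    split_ifs
    · ring
    · rw [pairsGe_one_eq hd n]

/-- `meetPairs d n = d^{2n} · meetProb d n 0`. [cite: CoxDurrett1983, §3] -/
theorem meetPairs_eq (hd : 1 ≤ d) (n : ℕ) : meetPairs d n = (d : ℝ) ^ (2 * n) * meetProb d n 0 :=
  pairsGe_one_eq hd n 0

/-- **First-meeting decomposition**: `meetProb d n z = Σ_{k<n} firstMeet d k z`
(`P(meet within n) = Σ_{k<n} P(τ̂ = k)`). [cite: BockEtAl2020, §4 (`ρ_d = Σ_k P(τ̂ = k)`)] -/
theorem meetProb_eq_sum_firstMeet (hd : 1 ≤ d) : ∀ (n : ℕ) (z : Site d),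
    meetProb d n z = ∑ k ∈ range n, firstMeet d k z
  | 0, z => by simp
  | n + 1, z => by
    have hd0 : (d : ℝ) ≠ 0 := by exact_mod_cast (show d ≠ 0 by omega)
    rw [Finset.sum_range_succ', meetProb_succ]
    -- split the `if` into the immediate meeting and the continuation
    have hsplit : ∀ a a' : Fin d,
        (if z = 0 ∧ a = a' then (1 : ℝ) else meetProb d n (z + Pi.single a 1 - Pi.single a' 1)) =
          (if z = 0 ∧ a = a' then (1 : ℝ) else 0) +
            ∑ k ∈ range n, (if z = 0 ∧ a = a' then (0 : ℝ)
              else firstMeet d k (z + Pi.single a 1 - Pi.single a' 1)) := by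
      intro a a'
      split_ifs with h
      · simp
      · rw [zero_add, meetProb_eq_sum_firstMeet hd n]
    -- the immediate meeting: `d^{-2} #{a = a'} = 1/d` when `z = 0`
    have hA : ((d : ℝ) ^ 2)⁻¹ * ∑ a : Fin d, ∑ a' : Fin d, (if z = 0 ∧ a = a' then (1 : ℝ) else 0) =
        firstMeet d 0 z := by
      rw [firstMeet_zero]
      by_cases hz : z = 0
      · simp only [hz, true_and, sum_sum_boole_eq, if_true]
        field_simp
      · simp [hz]
    -- the continuation: exchange the sums and recognise `firstMeet d (k+1) z`
    have hB : ((d : ℝ) ^ 2)⁻¹ * ∑ a : Fin d, ∑ a' : Fin d, ∑ k ∈ range n,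
        (if z = 0 ∧ a = a' then (0 : ℝ) else firstMeet d k (z + Pi.single a 1 - Pi.single a' 1)) =
        ∑ k ∈ range n, firstMeet d (k + 1) z := by
      simp_rw [firstMeet_succ]
      rw [← Finset.mul_sum]
      congr 1
      exact sum_sum_sum_comm _ _ _ _
    calc ((d : ℝ) ^ 2)⁻¹ * ∑ a : Fin d, ∑ a' : Fin d,
          (if z = 0 ∧ a = a' then (1 : ℝ) else meetProb d n (z + Pi.single a 1 - Pi.single a' 1))
        = ((d : ℝ) ^ 2)⁻¹ * ∑ a : Fin d, ∑ a' : Fin d,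
            ((if z = 0 ∧ a = a' then (1 : ℝ) else 0) +
              ∑ k ∈ range n, (if z = 0 ∧ a = a' then (0 : ℝ)
                else firstMeet d k (z + Pi.single a 1 - Pi.single a' 1))) := by
          congr 1
          exact Finset.sum_congr rfl fun a _ => Finset.sum_congr rfl fun a' _ => hsplit a a'
      _ = ((d : ℝ) ^ 2)⁻¹ * ∑ a : Fin d, ∑ a' : Fin d, (if z = 0 ∧ a = a' then (1 : ℝ) else 0) +
          ((d : ℝ) ^ 2)⁻¹ * ∑ a : Fin d, ∑ a' : Fin d, ∑ k ∈ range n,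
            (if z = 0 ∧ a = a' then (0 : ℝ)
              else firstMeet d k (z + Pi.single a 1 - Pi.single a' 1)) := by
          rw [← mul_add, ← Finset.sum_add_distrib]
          congr 1
          exact Finset.sum_congr rfl fun a _ => Finset.sum_add_distrib
      _ = firstMeet d 0 z + ∑ k ∈ range n, firstMeet d (k + 1) z := by rw [hA, hB]
      _ = ∑ k ∈ range n, firstMeet d (k + 1) z + firstMeet d 0 z := add_comm _ _

/-- `P(τ̂ = k) ≤ P(S'_k - S_k = ·)/d`: dropping the "not met before" restriction.
[cite: BockEtAl2020, §4 (`P(τ̂ = k) ≤ (1/d) max_x P(S_k = x)`)] -/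
theorem firstMeet_le (hd : 1 ≤ d) : ∀ (k : ℕ) (z : Site d), firstMeet d k z ≤ diffProb d k z / d
  | 0, z => by
    rw [firstMeet_zero, diffProb_zero]
    split_ifs <;> simp
  | k + 1, z => by
    rw [firstMeet_succ, diffProb_succ]
    calc ((d : ℝ) ^ 2)⁻¹ * ∑ a : Fin d, ∑ a' : Fin d,
          (if z = 0 ∧ a = a' then (0 : ℝ) else firstMeet d k (z + Pi.single a 1 - Pi.single a' 1))
        ≤ ((d : ℝ) ^ 2)⁻¹ * ∑ a : Fin d, ∑ a' : Fin d,
            diffProb d k (z + Pi.single a 1 - Pi.single a' 1) / d := by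
          refine mul_le_mul_of_nonneg_left
            (Finset.sum_le_sum fun a _ => Finset.sum_le_sum fun a' _ => ?_) (by positivity)
          split_ifs
          · exact div_nonneg (diffProb_nonneg _ _ _) (Nat.cast_nonneg _)
          · exact firstMeet_le hd k _
      _ = ((d : ℝ) ^ 2)⁻¹ * (∑ a : Fin d, ∑ a' : Fin d,
            diffProb d k (z + Pi.single a 1 - Pi.single a' 1)) / d := by
          rw [mul_div_assoc, Finset.sum_div]
          simp_rw [Finset.sum_div]

/-! ### The first five values at the origin -/

/-- `P(τ̂ = 0) = 1/d`. [cite: BockEtAl2020, §4 (`P(τ̂ = 0) = 1/d`)] -/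
theorem firstMeet_zero_zero : firstMeet d 0 (0 : Site d) = ((d : ℝ))⁻¹ := by
  rw [firstMeet_zero, if_pos rfl]

/-- `firstMeet d 1 v ≤ 1/d³` for every `v` (at most one step `(c, c')` has `v + e_c = e_{c'}`).
[cite: BockEtAl2020, §4] -/
theorem firstMeet_one_le (hd : 1 ≤ d) (v : Site d) : firstMeet d 1 v ≤ 1 / (d : ℝ) ^ 3 := by
  have hd0 : (0 : ℝ) < d := by exact_mod_cast hd
  rw [firstMeet_succ]
  -- the summand is `1/d` times an indicator, and at most one indicator is `1`
  have hterm : ∀ c c' : Fin d,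
      (if v = 0 ∧ c = c' then (0 : ℝ) else firstMeet d 0 (v + Pi.single c 1 - Pi.single c' 1)) =
        ((d : ℝ))⁻¹ * (if v + Pi.single c 1 - Pi.single c' 1 = 0 ∧ ¬ (v = 0 ∧ c = c')
          then 1 else 0) := by
    intro c c'
    rw [firstMeet_zero]
    by_cases h1 : v = 0 ∧ c = c'
    · simp [h1]
    · by_cases h2 : v + Pi.single c 1 - Pi.single c' 1 = 0
      · simp [h1, h2]
      · simp [h1, h2]
  simp_rw [hterm]
  rw [show ∑ c : Fin d, ∑ c' : Fin d, ((d : ℝ))⁻¹ *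
      (if v + Pi.single c 1 - Pi.single c' 1 = 0 ∧ ¬ (v = 0 ∧ c = c') then (1 : ℝ) else 0) =
      ((d : ℝ))⁻¹ * ∑ c : Fin d, ∑ c' : Fin d,
        (if v + Pi.single c 1 - Pi.single c' 1 = 0 ∧ ¬ (v = 0 ∧ c = c') then (1 : ℝ) else 0) by
    rw [Finset.mul_sum]
    exact Finset.sum_congr rfl fun c _ => (Finset.mul_sum _ _ _).symm]
  have hcount : ∑ c : Fin d, ∑ c' : Fin d,
      (if v + Pi.single c 1 - Pi.single c' 1 = 0 ∧ ¬ (v = 0 ∧ c = c') then (1 : ℝ) else 0) ≤ 1 := by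
    by_cases hsol : ∃ c₀ c₀' : Fin d, v + Pi.single c₀ 1 - Pi.single c₀' 1 = 0 ∧ ¬ (v = 0 ∧ c₀ = c₀')
    · obtain ⟨c₀, c₀', h₀, hne⟩ := hsol
      have hv : v = Pi.single c₀' 1 - Pi.single c₀ 1 := by linear_combination h₀
      have hcc : c₀' ≠ c₀ := by
        rintro rfl
        rw [sub_self] at hv
        exact hne ⟨hv, rfl⟩
      refine le_trans (Finset.sum_le_sum fun c _ => Finset.sum_le_sum fun c' _ => ?_)
        (sum_sum_boole_pair_le c₀ c₀')
      split_ifs with h1 h2 h2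
      · exact le_rfl
      · exfalso
        apply h2
        rw [hv] at h1
        exact (succ_S2_eq_zero_iff hcc c c').1 h1.1
      · norm_num
      · exact le_rfl
    · push Not at hsol
      refine le_trans (Finset.sum_le_sum fun c _ => Finset.sum_le_sum fun c' _ => ?_)
        (by simp : ∑ c : Fin d, ∑ c' : Fin d, (0 : ℝ) ≤ 1)
      rw [if_neg]
      exact fun h => h.2 (hsol c c' h.1)
  calc ((d : ℝ) ^ 2)⁻¹ * (((d : ℝ))⁻¹ * ∑ c : Fin d, ∑ c' : Fin d,
        (if v + Pi.single c 1 - Pi.single c' 1 = 0 ∧ ¬ (v = 0 ∧ c = c') then (1 : ℝ) else 0))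
      ≤ ((d : ℝ) ^ 2)⁻¹ * (((d : ℝ))⁻¹ * 1) := by gcongr
    _ = 1 / (d : ℝ) ^ 3 := by field_simp

/-- `firstMeet d 1 v = 0` unless `v ∈ S₂` (a common step right after offset `v` needs
`v = e_{c'} - e_c` with `c ≠ c'`). [cite: BockEtAl2020, §4 (`P(τ̂ = 1) = 0`)] -/
theorem firstMeet_one_eq_zero (v : Site d) (hv : ¬ IsS2 v) : firstMeet d 1 v = 0 := by
  rw [firstMeet_succ]
  refine mul_eq_zero_of_right _ (Finset.sum_eq_zero fun c _ => Finset.sum_eq_zero fun c' _ => ?_)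
  split_ifs with h1
  · rfl
  · rw [firstMeet_zero, if_neg]
    intro h0
    have hv' : v = Pi.single c' 1 - Pi.single c 1 := by linear_combination h0
    by_cases hcc : c = c'
    · subst hcc
      rw [sub_self] at hv'
      exact h1 ⟨hv', rfl⟩
    · exact hv ⟨c', c, Ne.symm hcc, hv'⟩

/-- `P(τ̂ = 1) = 0`. [cite: BockEtAl2020, §4 (`P(τ̂ = 1) = 0`)] -/
theorem firstMeet_one_zero : firstMeet d 1 (0 : Site d) = 0 :=
  firstMeet_one_eq_zero 0 fun h => h.ne_zero rfl

/-- From an `S₂` offset, `firstMeet d 2 ≤ 3/d⁴` (at most `3d` steps stay in `S₂ ∪ {0}`, each then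
meets with density `≤ 1/d³`). [cite: BockEtAl2020, §4] -/
theorem firstMeet_two_le_of_isS2 (hd : 1 ≤ d) {y : Site d} (hy : IsS2 y) :
    firstMeet d 2 y ≤ 3 / (d : ℝ) ^ 4 := by
  have hd0 : (0 : ℝ) < d := by exact_mod_cast hd
  obtain ⟨i, j, hij, rfl⟩ := hy
  rw [firstMeet_succ_of_ne_zero _ (isS2_single_sub_single hij).ne_zero]
  have hterm : ∀ b b' : Fin d,
      firstMeet d 1 (Pi.single i 1 - Pi.single j 1 + Pi.single b 1 - Pi.single b' 1) ≤
        (if b = b' ∨ b = j ∨ b' = i then (1 : ℝ) else 0) * (1 / (d : ℝ) ^ 3) := by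
    intro b b'
    split_ifs with h
    · rw [one_mul]
      exact firstMeet_one_le hd _
    · rw [zero_mul]
      push Not at h
      exact (firstMeet_one_eq_zero _ (succ_far_not_isS2 hij h.1 h.2.1 h.2.2)).le
  calc ((d : ℝ) ^ 2)⁻¹ * ∑ b : Fin d, ∑ b' : Fin d,
        firstMeet d 1 (Pi.single i 1 - Pi.single j 1 + Pi.single b 1 - Pi.single b' 1)
      ≤ ((d : ℝ) ^ 2)⁻¹ * ∑ b : Fin d, ∑ b' : Fin d,
          (if b = b' ∨ b = j ∨ b' = i then (1 : ℝ) else 0) * (1 / (d : ℝ) ^ 3) := by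
        exact mul_le_mul_of_nonneg_left
          (Finset.sum_le_sum fun b _ => Finset.sum_le_sum fun b' _ => hterm b b') (by positivity)
    _ = ((d : ℝ) ^ 2)⁻¹ * ((∑ b : Fin d, ∑ b' : Fin d,
          (if b = b' ∨ b = j ∨ b' = i then (1 : ℝ) else 0)) * (1 / (d : ℝ) ^ 3)) := by
        rw [Finset.sum_mul]
        congr 1
        exact Finset.sum_congr rfl fun b _ => (Finset.sum_mul _ _ _).symm
    _ ≤ ((d : ℝ) ^ 2)⁻¹ * ((3 * d) * (1 / (d : ℝ) ^ 3)) := by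
        gcongr
        exact sum_sum_boole_succ_S2_le i j
    _ = 3 / (d : ℝ) ^ 4 := by
        field_simp

/-- From a far offset, `firstMeet d 2 ≤ 4/d⁵` (at most `4` steps return to `S₂`).
[cite: BockEtAl2020, §4 (case (C))] -/
theorem firstMeet_two_far_le (hd : 1 ≤ d) {i j a a' : Fin d} (hij : i ≠ j) (haa : a ≠ a')
    (haj : a ≠ j) (hai : a' ≠ i) :
    firstMeet d 2 (Pi.single i 1 - Pi.single j 1 + Pi.single a 1 - Pi.single a' 1) ≤
      4 / (d : ℝ) ^ 5 := by
  have hd0 : (0 : ℝ) < d := by exact_mod_cast hd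
  rw [firstMeet_succ_of_ne_zero _ (succ_far_ne_zero hij haa haj hai)]
  have hterm : ∀ b b' : Fin d,
      firstMeet d 1 (Pi.single i 1 - Pi.single j 1 + Pi.single a 1 - Pi.single a' 1 +
        Pi.single b 1 - Pi.single b' 1) ≤
        (if (b' = i ∨ b' = a) ∧ (b = j ∨ b = a') then (1 : ℝ) else 0) * (1 / (d : ℝ) ^ 3) := by
    intro b b'
    split_ifs with h
    · rw [one_mul]
      exact firstMeet_one_le hd _
    · rw [zero_mul]
      refine (firstMeet_one_eq_zero _ fun hS => h ?_).le
      exact succ_far_S2 hij haa haj hai hS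
  calc ((d : ℝ) ^ 2)⁻¹ * ∑ b : Fin d, ∑ b' : Fin d,
        firstMeet d 1 (Pi.single i 1 - Pi.single j 1 + Pi.single a 1 - Pi.single a' 1 +
          Pi.single b 1 - Pi.single b' 1)
      ≤ ((d : ℝ) ^ 2)⁻¹ * ∑ b : Fin d, ∑ b' : Fin d,
          (if (b' = i ∨ b' = a) ∧ (b = j ∨ b = a') then (1 : ℝ) else 0) * (1 / (d : ℝ) ^ 3) := by
        exact mul_le_mul_of_nonneg_left
          (Finset.sum_le_sum fun b _ => Finset.sum_le_sum fun b' _ => hterm b b') (by positivity)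
    _ = ((d : ℝ) ^ 2)⁻¹ * ((∑ b : Fin d, ∑ b' : Fin d,
          (if (b' = i ∨ b' = a) ∧ (b = j ∨ b = a') then (1 : ℝ) else 0)) * (1 / (d : ℝ) ^ 3)) := by
        rw [Finset.sum_mul]
        congr 1
        exact Finset.sum_congr rfl fun b _ => (Finset.sum_mul _ _ _).symm
    _ ≤ ((d : ℝ) ^ 2)⁻¹ * (4 * (1 / (d : ℝ) ^ 3)) := by
        gcongr
        exact sum_sum_boole_far_le i a j a'
    _ = 4 / (d : ℝ) ^ 5 := by
        field_simp

/-- `Σ_{a,a'} 1[a ≠ a'] · c = (d² - d) c`. [folklore] -/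
theorem sum_sum_ite_ne_const (d : ℕ) (c : ℝ) :
    ∑ a : Fin d, ∑ a' : Fin d, (if a = a' then (0 : ℝ) else c) = ((d : ℝ) ^ 2 - d) * c := by
  have h : ∀ a a' : Fin d, (if a = a' then (0 : ℝ) else c) = c - (if a = a' then c else 0) := by
    intro a a'
    split_ifs <;> ring
  simp_rw [h, Finset.sum_sub_distrib, Finset.sum_ite_eq, Finset.mem_univ, if_true,
    Finset.sum_const, Finset.card_univ, Fintype.card_fin, nsmul_eq_mul]
  ring

/-- `P(τ̂ = 2) ≤ (1 - 1/d)/d³` (BDNS: `= 1/d³ - 1/d⁴`). [cite: BockEtAl2020, §4 (`P(τ̂ = 2)`)] -/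
theorem firstMeet_two_zero_le (hd : 1 ≤ d) :
    firstMeet d 2 (0 : Site d) ≤ (1 - 1 / (d : ℝ)) / (d : ℝ) ^ 3 := by
  have hd0 : (0 : ℝ) < d := by exact_mod_cast hd
  rw [firstMeet_succ_zero]
  calc ((d : ℝ) ^ 2)⁻¹ * ∑ a : Fin d, ∑ a' : Fin d,
        (if a = a' then (0 : ℝ) else firstMeet d 1 (Pi.single a 1 - Pi.single a' 1))
      ≤ ((d : ℝ) ^ 2)⁻¹ * ∑ a : Fin d, ∑ a' : Fin d,
          (if a = a' then (0 : ℝ) else 1 / (d : ℝ) ^ 3) := by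
        refine mul_le_mul_of_nonneg_left
          (Finset.sum_le_sum fun a _ => Finset.sum_le_sum fun a' _ => ?_) (by positivity)
        split_ifs
        · exact le_rfl
        · exact firstMeet_one_le hd _
    _ = (1 - 1 / (d : ℝ)) / (d : ℝ) ^ 3 := by
        rw [sum_sum_ite_ne_const]
        field_simp

/-- `P(τ̂ = 3) ≤ 3(1 - 1/d)/d⁴` (BDNS: `= (1 - 1/d)(3d - 4)/d⁵`). [cite: BockEtAl2020, §4 (`P(τ̂ = 3)`)] -/
theorem firstMeet_three_zero_le (hd : 1 ≤ d) :
    firstMeet d 3 (0 : Site d) ≤ 3 * (1 - 1 / (d : ℝ)) / (d : ℝ) ^ 4 := by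
  have hd0 : (0 : ℝ) < d := by exact_mod_cast hd
  rw [firstMeet_succ_zero]
  calc ((d : ℝ) ^ 2)⁻¹ * ∑ a : Fin d, ∑ a' : Fin d,
        (if a = a' then (0 : ℝ) else firstMeet d 2 (Pi.single a 1 - Pi.single a' 1))
      ≤ ((d : ℝ) ^ 2)⁻¹ * ∑ a : Fin d, ∑ a' : Fin d,
          (if a = a' then (0 : ℝ) else 3 / (d : ℝ) ^ 4) := by
        refine mul_le_mul_of_nonneg_left
          (Finset.sum_le_sum fun a _ => Finset.sum_le_sum fun a' _ => ?_) (by positivity)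
        split_ifs with h
        · exact le_rfl
        · exact firstMeet_two_le_of_isS2 hd (isS2_single_sub_single h)
    _ = 3 * (1 - 1 / (d : ℝ)) / (d : ℝ) ^ 4 := by
        rw [sum_sum_ite_ne_const]
        field_simp

/-- From an `S₂` offset, `firstMeet d 3 ≤ (14 - 1/d)/d⁵`: the successor is `0` (at most once,
contributing `P(τ̂ = 2)`-type density `(1 - 1/d)/d³`), in `S₂` (at most `3d` times, `3/d⁴` each) or
far (at most `d²` times, `4/d⁵` each).  BDNS's exact count gives
`(1/d²)[(1 - 1/d)/d³ + (3d-4)²/d⁵ + 4(d² - 3d + 3)/d⁵]`. [cite: BockEtAl2020, §4 (`P(τ̂ = 4)`)] -/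
theorem firstMeet_three_le_of_isS2 (hd : 1 ≤ d) {y : Site d} (hy : IsS2 y) :
    firstMeet d 3 y ≤ (14 - 1 / (d : ℝ)) / (d : ℝ) ^ 5 := by
  have hd0 : (0 : ℝ) < d := by exact_mod_cast hd
  obtain ⟨i, j, hij, rfl⟩ := hy
  rw [firstMeet_succ_of_ne_zero _ (isS2_single_sub_single hij).ne_zero]
  -- termwise bound through the three classes
  have hterm : ∀ a a' : Fin d,
      firstMeet d 2 (Pi.single i 1 - Pi.single j 1 + Pi.single a 1 - Pi.single a' 1) ≤
        (if a = j ∧ a' = i then (1 : ℝ) else 0) * ((1 - 1 / (d : ℝ)) / (d : ℝ) ^ 3) +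
          (if a = a' ∨ a = j ∨ a' = i then (1 : ℝ) else 0) * (3 / (d : ℝ) ^ 4) +
            4 / (d : ℝ) ^ 5 := by
    intro a a'
    have h4 : (0 : ℝ) ≤ 4 / (d : ℝ) ^ 5 := by positivity
    have h3 : (0 : ℝ) ≤ (if a = a' ∨ a = j ∨ a' = i then (1 : ℝ) else 0) * (3 / (d : ℝ) ^ 4) := by
      positivity
    have h1 : (0 : ℝ) ≤ (if a = j ∧ a' = i then (1 : ℝ) else 0) * ((1 - 1 / (d : ℝ)) / (d : ℝ) ^ 3) := by
      have : (0 : ℝ) ≤ 1 - 1 / (d : ℝ) := by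
        rw [sub_nonneg, div_le_one hd0]
        exact_mod_cast hd
      positivity
    by_cases h0 : a = j ∧ a' = i
    · rw [(succ_S2_eq_zero_iff hij a a').2 h0, if_pos h0, one_mul]
      linarith [firstMeet_two_zero_le (d := d) hd]
    · by_cases hC : a = a' ∨ a = j ∨ a' = i
      · have hS : IsS2 (Pi.single i (1 : ℤ) - Pi.single j 1 + Pi.single a 1 - Pi.single a' 1) := by
          rcases hC with rfl | rfl | rfl
          · rw [add_sub_cancel_right]
            exact isS2_single_sub_single hij
          · have hne : i ≠ a' := fun h => h0 ⟨rfl, h.symm⟩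
            refine ⟨i, a', hne, ?_⟩
            abel
          · have hne : a ≠ j := fun h => h0 ⟨h, rfl⟩
            refine ⟨a, j, hne, ?_⟩
            abel
        rw [if_pos hC, one_mul]
        linarith [firstMeet_two_le_of_isS2 hd hS]
      · push Not at hC
        linarith [firstMeet_two_far_le hd hij hC.1 hC.2.1 hC.2.2]
  calc ((d : ℝ) ^ 2)⁻¹ * ∑ a : Fin d, ∑ a' : Fin d,
        firstMeet d 2 (Pi.single i 1 - Pi.single j 1 + Pi.single a 1 - Pi.single a' 1)
      ≤ ((d : ℝ) ^ 2)⁻¹ * ∑ a : Fin d, ∑ a' : Fin d,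
          ((if a = j ∧ a' = i then (1 : ℝ) else 0) * ((1 - 1 / (d : ℝ)) / (d : ℝ) ^ 3) +
            (if a = a' ∨ a = j ∨ a' = i then (1 : ℝ) else 0) * (3 / (d : ℝ) ^ 4) +
              4 / (d : ℝ) ^ 5) := by
        exact mul_le_mul_of_nonneg_left
          (Finset.sum_le_sum fun a _ => Finset.sum_le_sum fun a' _ => hterm a a') (by positivity)
    _ = ((d : ℝ) ^ 2)⁻¹ *
          ((∑ a : Fin d, ∑ a' : Fin d, (if a = j ∧ a' = i then (1 : ℝ) else 0)) *
              ((1 - 1 / (d : ℝ)) / (d : ℝ) ^ 3) +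
            (∑ a : Fin d, ∑ a' : Fin d, (if a = a' ∨ a = j ∨ a' = i then (1 : ℝ) else 0)) *
              (3 / (d : ℝ) ^ 4) +
            (d : ℝ) ^ 2 * (4 / (d : ℝ) ^ 5)) := by
        congr 1
        simp only [Finset.sum_add_distrib, Finset.sum_mul, Finset.sum_const, Finset.card_univ,
          Fintype.card_fin, nsmul_eq_mul]
        ring
    _ ≤ ((d : ℝ) ^ 2)⁻¹ * (1 * ((1 - 1 / (d : ℝ)) / (d : ℝ) ^ 3) + (3 * d) * (3 / (d : ℝ) ^ 4) +
          (d : ℝ) ^ 2 * (4 / (d : ℝ) ^ 5)) := by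
        have hnn : (0 : ℝ) ≤ 1 - 1 / (d : ℝ) := by
          rw [sub_nonneg, div_le_one hd0]
          exact_mod_cast hd
        gcongr
        · exact sum_sum_boole_pair_le j i
        · exact sum_sum_boole_succ_S2_le i j
    _ = (14 - 1 / (d : ℝ)) / (d : ℝ) ^ 5 := by
        field_simp
        ring

/-- `P(τ̂ = 4) ≤ (1 - 1/d)(14 - 1/d)/d⁵`. [cite: BockEtAl2020, §4 (`P(τ̂ = 4)`)] -/
theorem firstMeet_four_zero_le (hd : 1 ≤ d) :
    firstMeet d 4 (0 : Site d) ≤ (1 - 1 / (d : ℝ)) * (14 - 1 / (d : ℝ)) / (d : ℝ) ^ 5 := by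
  have hd0 : (0 : ℝ) < d := by exact_mod_cast hd
  rw [firstMeet_succ_zero]
  calc ((d : ℝ) ^ 2)⁻¹ * ∑ a : Fin d, ∑ a' : Fin d,
        (if a = a' then (0 : ℝ) else firstMeet d 3 (Pi.single a 1 - Pi.single a' 1))
      ≤ ((d : ℝ) ^ 2)⁻¹ * ∑ a : Fin d, ∑ a' : Fin d,
          (if a = a' then (0 : ℝ) else (14 - 1 / (d : ℝ)) / (d : ℝ) ^ 5) := by
        refine mul_le_mul_of_nonneg_left
          (Finset.sum_le_sum fun a _ => Finset.sum_le_sum fun a' _ => ?_) (by positivity)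
        split_ifs with h
        · exact le_rfl
        · exact firstMeet_three_le_of_isS2 hd (isS2_single_sub_single h)
    _ = (1 - 1 / (d : ℝ)) * (14 - 1 / (d : ℝ)) / (d : ℝ) ^ 5 := by
        rw [sum_sum_ite_ne_const]
        field_simp

/-! ### The explicit bound -/

/-- The head `P(τ̂ ≤ 4) ≤ 1/d + (1 - 1/d)/d³ + 3(1 - 1/d)/d⁴ + (1 - 1/d)(14 - 1/d)/d⁵` of the
bound (4.11) (with BDNS's exact counts `3d - 4`, `d² - 3d + 3` replaced by `3d`, `d²`).
[cite: BockEtAl2020, §4 (4.11)] -/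
def rhoHead (d : ℕ) : ℝ :=
  1 / d + (1 - 1 / (d : ℝ)) / (d : ℝ) ^ 3 + 3 * (1 - 1 / (d : ℝ)) / (d : ℝ) ^ 4 +
    (1 - 1 / (d : ℝ)) * (14 - 1 / (d : ℝ)) / (d : ℝ) ^ 5

/-- The middle part `Σ_{k=5}^{d} k!/d^{k+1}` of (4.11) (`P(5 ≤ τ̂ ≤ d)`). [cite: BockEtAl2020, §4 (4.11)] -/
def rhoMid (d : ℕ) : ℝ := ∑ k ∈ Ico 5 (d + 1), (k ! : ℝ) / (d : ℝ) ^ (k + 1)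

/-- The general term `(jd)!/((j!)^d d^{jd})` of the tail series of (4.11) (`P(d < τ̂ < ∞)`).
[cite: BockEtAl2020, §4 (4.11)] -/
def balancedTerm (d j : ℕ) : ℝ := ((j * d)! : ℝ) / ((j ! : ℝ) ^ d * (d : ℝ) ^ (j * d))

/-- `balancedTerm ≥ 0`. [folklore] -/
theorem balancedTerm_nonneg (d j : ℕ) : 0 ≤ balancedTerm d j := by
  unfold balancedTerm
  positivity

/-- `rhoMid ≥ 0`. [folklore] -/
theorem rhoMid_nonneg (d : ℕ) : 0 ≤ rhoMid d :=
  Finset.sum_nonneg fun k _ => by positivity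

/-- `rhoHead ≥ 0` for `d ≥ 1`. [folklore] -/
theorem rhoHead_nonneg (hd : 1 ≤ d) : 0 ≤ rhoHead d := by
  have hd0 : (0 : ℝ) < d := by exact_mod_cast hd
  have h1 : (0 : ℝ) ≤ 1 - 1 / (d : ℝ) := by
    rw [sub_nonneg, div_le_one hd0]; exact_mod_cast hd
  have h2 : (0 : ℝ) ≤ 14 - 1 / (d : ℝ) := by
    have : 1 / (d : ℝ) ≤ 1 := by rw [div_le_one hd0]; exact_mod_cast hd
    linarith
  unfold rhoHead
  positivity

/-- `P(τ̂ ≤ 4) ≤ rhoHead d`. [cite: BockEtAl2020, §4 (4.11)] -/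
theorem sum_firstMeet_head_le (hd : 1 ≤ d) :
    ∑ k ∈ range 5, firstMeet d k (0 : Site d) ≤ rhoHead d := by
  simp only [Finset.sum_range_succ, Finset.sum_range_zero, zero_add, firstMeet_zero_zero,
    firstMeet_one_zero, add_zero, rhoHead, one_div]
  have h2 := firstMeet_two_zero_le (d := d) hd
  have h3 := firstMeet_three_zero_le (d := d) hd
  have h4 := firstMeet_four_zero_le (d := d) hd
  simp only [one_div] at h2 h3 h4
  linarith

/-- `P(5 ≤ τ̂ ≤ d, τ̂ < n) ≤ rhoMid d`. [cite: BockEtAl2020, §4 (4.11), (4.8)] -/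
theorem sum_firstMeet_mid_le (hd : 1 ≤ d) (n : ℕ) :
    ∑ k ∈ Ico 5 (min n (d + 1)), firstMeet d k (0 : Site d) ≤ rhoMid d := by
  calc ∑ k ∈ Ico 5 (min n (d + 1)), firstMeet d k (0 : Site d)
      ≤ ∑ k ∈ Ico 5 (d + 1), firstMeet d k (0 : Site d) :=
        Finset.sum_le_sum_of_subset_of_nonneg (Finset.Ico_subset_Ico_right (min_le_right _ _))
          fun k _ _ => firstMeet_nonneg k 0
    _ ≤ rhoMid d := Finset.sum_le_sum fun k _ => ?_
  calc firstMeet d k 0 ≤ diffProb d k 0 / d := firstMeet_le hd k 0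
    _ ≤ (k ! / (d : ℝ) ^ k) / d := by gcongr; exact diffProb_le_factorial_div d k 0
    _ = (k ! : ℝ) / (d : ℝ) ^ (k + 1) := by rw [div_div, pow_succ]

/-- For `k > d`, `P(τ̂ = k) ≤ balancedTerm d ((k-1)/d) / d`. [cite: BockEtAl2020, §4 (4.9)] -/
theorem firstMeet_le_balancedTerm (hd : 1 ≤ d) {k : ℕ} (hk : d + 1 ≤ k) :
    firstMeet d k (0 : Site d) ≤ balancedTerm d ((k - 1) / d) / d := by
  have hk' : k = (k - 1) / d * d + ((k - 1) % d + 1) := by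
    have := Nat.div_add_mod (k - 1) d
    rw [mul_comm] at this
    omega
  calc firstMeet d k 0 ≤ diffProb d k 0 / d := firstMeet_le hd k 0
    _ ≤ balancedTerm d ((k - 1) / d) / d := by
        gcongr
        rw [balancedTerm]
        conv_lhs => rw [hk']
        exact diffProb_le_balanced hd _ _ 0

/-- `P(d < τ̂ < n) ≤ Σ_{j=1}^{n} balancedTerm d j` (each block `(jd, (j+1)d]` has `d` indices).
[cite: BockEtAl2020, §4 (4.11), (4.9)] -/
theorem sum_firstMeet_tail_le (hd : 1 ≤ d) (n : ℕ) :
    ∑ k ∈ Ico (d + 1) n, firstMeet d k (0 : Site d) ≤ ∑ j ∈ Icc 1 n, balancedTerm d j := by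
  have hd0 : (0 : ℝ) < d := by exact_mod_cast hd
  have hmaps : ∀ k ∈ Ico (d + 1) n, (k - 1) / d ∈ Icc 1 n := by
    intro k hk
    rw [Finset.mem_Ico] at hk
    rw [Finset.mem_Icc]
    constructor
    · exact (Nat.le_div_iff_mul_le hd).2 (by omega)
    · exact (Nat.div_le_self _ _).trans (by omega)
  calc ∑ k ∈ Ico (d + 1) n, firstMeet d k (0 : Site d)
      ≤ ∑ k ∈ Ico (d + 1) n, balancedTerm d ((k - 1) / d) / d :=
        Finset.sum_le_sum fun k hk => firstMeet_le_balancedTerm hd (Finset.mem_Ico.1 hk).1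
    _ = ∑ j ∈ Icc 1 n, ∑ k ∈ (Ico (d + 1) n).filter (fun k => (k - 1) / d = j),
          balancedTerm d ((k - 1) / d) / d :=
        (Finset.sum_fiberwise_of_maps_to hmaps _).symm
    _ = ∑ j ∈ Icc 1 n, (((Ico (d + 1) n).filter (fun k => (k - 1) / d = j)).card : ℝ) *
          (balancedTerm d j / d) := by
        refine Finset.sum_congr rfl fun j _ => ?_
        rw [Finset.sum_congr rfl fun k hk => by rw [(Finset.mem_filter.1 hk).2], Finset.sum_const,
          nsmul_eq_mul]
    _ ≤ ∑ j ∈ Icc 1 n, (d : ℝ) * (balancedTerm d j / d) := by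
        refine Finset.sum_le_sum fun j _ => mul_le_mul_of_nonneg_right ?_
          (div_nonneg (balancedTerm_nonneg d j) hd0.le)
        have hsub : (Ico (d + 1) n).filter (fun k => (k - 1) / d = j) ⊆ Icc (j * d + 1) (j * d + d) := by
          intro k hk
          rw [Finset.mem_filter, Finset.mem_Ico] at hk
          rw [Finset.mem_Icc]
          have h1 := Nat.div_add_mod (k - 1) d
          have h2 := Nat.mod_lt (k - 1) (show 0 < d from hd)
          rw [hk.2] at h1
          constructor
          · have : j * d ≤ k - 1 := by rw [mul_comm]; omega
            omega
          · have : k - 1 < j * d + d := by rw [mul_comm]; omega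
            omega
        calc (((Ico (d + 1) n).filter (fun k => (k - 1) / d = j)).card : ℝ)
            ≤ ((Icc (j * d + 1) (j * d + d)).card : ℝ) := by exact_mod_cast Finset.card_le_card hsub
          _ = d := by
              have : j * d + d + 1 - (j * d + 1) = d := by omega
              rw [Nat.card_Icc, this]
    _ = ∑ j ∈ Icc 1 n, balancedTerm d j :=
        Finset.sum_congr rfl fun j _ => by field_simp

/-- Subadditivity of sums of nonnegative terms over a union. [folklore] -/
private theorem sum_union_le_of_nonneg {ι : Type*} [DecidableEq ι] {s t : Finset ι} {f : ι → ℝ}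
    (hf : ∀ i, 0 ≤ f i) : ∑ i ∈ s ∪ t, f i ≤ ∑ i ∈ s, f i + ∑ i ∈ t, f i := by
  rw [← Finset.sum_union_inter]
  exact le_add_of_nonneg_right (Finset.sum_nonneg fun i _ => hf i)

/-- **BDNS (4.11), finite form**: for every `n`,
`meetPairs d n / d^{2n} = P(τ̂ < n) ≤ rhoHead d + rhoMid d + Σ_{j=1}^{n} (jd)!/((j!)^d d^{jd})`.
[cite: BockEtAl2020, §4 (4.11)] -/
theorem meetProb_zero_le (hd : 1 ≤ d) (n : ℕ) :
    meetProb d n 0 ≤ rhoHead d + rhoMid d + ∑ j ∈ Icc 1 n, balancedTerm d j := by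
  rw [meetProb_eq_sum_firstMeet hd]
  have hsplit : range n ⊆ range 5 ∪ Ico 5 (min n (d + 1)) ∪ Ico (d + 1) n := by
    intro k hk
    rw [Finset.mem_range] at hk
    simp only [Finset.mem_union, Finset.mem_range, Finset.mem_Ico, lt_min_iff]
    omega
  have hnn : ∀ k, 0 ≤ firstMeet d k (0 : Site d) := fun k => firstMeet_nonneg k 0
  calc ∑ k ∈ range n, firstMeet d k (0 : Site d)
      ≤ ∑ k ∈ range 5 ∪ Ico 5 (min n (d + 1)) ∪ Ico (d + 1) n, firstMeet d k 0 :=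
        Finset.sum_le_sum_of_subset_of_nonneg hsplit fun k _ _ => hnn k
    _ ≤ ∑ k ∈ range 5, firstMeet d k 0 + ∑ k ∈ Ico 5 (min n (d + 1)), firstMeet d k 0 +
          ∑ k ∈ Ico (d + 1) n, firstMeet d k 0 :=
        (sum_union_le_of_nonneg hnn).trans (by gcongr; exact sum_union_le_of_nonneg hnn)
    _ ≤ rhoHead d + rhoMid d + ∑ j ∈ Icc 1 n, balancedTerm d j := by
        gcongr
        · exact sum_firstMeet_head_le hd
        · exact sum_firstMeet_mid_le hd n
        · exact sum_firstMeet_tail_le hd n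

/-- The same for the pair counts: `meetPairs d n ≤ (rhoHead d + rhoMid d + Σ_{j ≤ n} …) d^{2n}`.
[cite: BockEtAl2020, §4 (4.11)] -/
theorem meetPairs_le_rhoBound (hd : 1 ≤ d) (n : ℕ) :
    meetPairs d n ≤ (rhoHead d + rhoMid d + ∑ j ∈ Icc 1 n, balancedTerm d j) * (d : ℝ) ^ (2 * n) := by
  rw [meetPairs_eq hd, mul_comm]
  exact mul_le_mul_of_nonneg_right (meetProb_zero_le hd n) (by positivity)

/-- **`p_c(ℤ^d) ≤ ρ_d ≤ g(d)`** (Cox–Durrett + BDNS (4.11)): for any `T` dominating the partial sums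
`Σ_{j=1}^{n} (jd)!/((j!)^d d^{jd})`, `p_c(ℤ^d) ≤ rhoHead d + rhoMid d + T`.
[cite: BockEtAl2020, §4 (4.11) and Cor 1.5] -/
theorem criticalProb_zd_le_rho (hd : 1 ≤ d) {T : ℝ} (hT0 : 0 ≤ T)
    (hT : ∀ n, ∑ j ∈ Icc 1 n, balancedTerm d j ≤ T) :
    criticalProb (zdGraph d) 0 ≤ rhoHead d + rhoMid d + T := by
  refine criticalProb_zd_le_of_meetPairs_le hd
    (add_nonneg (add_nonneg (rhoHead_nonneg hd) (rhoMid_nonneg d)) hT0) fun m => ?_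
  calc meetPairs d m ≤ (rhoHead d + rhoMid d + ∑ j ∈ Icc 1 m, balancedTerm d j) * (d : ℝ) ^ (2 * m) :=
        meetPairs_le_rhoBound hd m
    _ ≤ (rhoHead d + rhoMid d + T) * (d : ℝ) ^ (2 * m) := by
        gcongr
        exact hT m

end Literature.Probability.Percolation

end
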